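import Summits.Parity.GeneralizedHardyLittlewood.Theorems.PrimeLevelFamEdgeMomentsBeyondDiagonalDiagBoseMixedStructure
import Summits.Parity.GeneralizedHardyLittlewood.Theorems.PrimeLevelFamEdgeMomentsBeyondDiagonalDiagBoseMixedMoments
import HarnessLib

/-!
# Route `PrimeLevelFamEdge`, crux K_A `MomentsBeyondDiagonal` (stmt-Parity-20007), line «petersson_layers» v4, stub `stub_diag`:
# **the four continued Bose remainders of order `(1,1)` are small on `(0,1]`:
# `c_ab(y) = Π_ab(log(1/y)) + O(y(1+log(1/y))^{a+b+1})`, `Π₀₀ = L/2+E₀₀`, `Π₀₁ = Π₁₀ = −L²/8+E`, `Π₁₁ = L³/24−2μ₂L+E₁₁`**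

Census R2 → (R) of `Cruxes/MomentsBeyondDiagonal/Lines/petersson_layers_stub_diag_g10_blocks.md`: the instances
`(a,b) ∈ {0,1}²` of `…DiagBoseMixedStructure.bose_coeff_structure` with `μ₀ = 1/4` (`…DiagBoseMixedMoments.integral_model_weight_Ioc`) and the vanishing
sign factors `(−1)^1 + (−1)^0 = 0`, in the remainder format `r_ab = c_ab − Π_ab(log(1/y))` of
`…DiagDecorOrderOneOneSplit` / hypothesis (R) of `…DiagDecorOrderOneOneAssembly.orderOneOne_target_of_remainder`
(constants `E_ab`, `μ₂` EXISTENTIAL, as (R) wants them):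

* `exists_bose_rem00_le`, `exists_bose_rem01_le`, `exists_bose_rem10_le`, `exists_bose_rem11_le`.

Def-free; theorems only. Helper `--supports stmt-Parity-20007`; closes nothing; K_A, K_B and the Parity summit are NOT proved;
nothing about Landau–Siegel zeros.

## References
* E. Kowalski, P. Michel, J. VanderKam, J. reine angew. Math. 526 (2000), (22)–(28) pp. 12–15.
  [cite: KowalskiMichelVanderKam2000, (22)–(28) — derivation (small-y structure of the diagonal weight coefficients)]
-/

noncomputable section

open Real Set MeasureTheory Finset

namespace Summit.Parity.GeneralizedHardyLittlewood.Theorems.MomentsBeyondDiagonal.DiagLines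

/-- `(a,b) = (0,0)`: the continued Bose remainder `c_00(y) − Π_00(log(1/y))` is `O(y(1+log(1/y))^1)` on `(0,1]`
(constants existential). [cite: KowalskiMichelVanderKam2000, (22)–(28) — derivation] -/
theorem exists_bose_rem00_le : ∃ E C : ℝ, ∀ y : ℝ, 0 < y → y ≤ 1 →
    |(∫ u₁ in Ioi (0 : ℝ), ∫ u₂ in Ioi (y / u₁), Real.exp (-(u₁ + u₂)) / (1 - Real.exp (-(u₁ + u₂))) ^ 2) -
        (Real.log (1 / y) / 2 + E)| ≤ C * y * (1 + Real.log (1 / y)) ^ 1 := by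
  obtain ⟨C, hC⟩ := bose_coeff_structure 0 0
  refine ⟨(∫ u₁ in Ioi (0 : ℝ), Real.log u₁ ^ 0 * ∫ u₂ in Ioi (1 / u₁), Real.exp (-(u₁ + u₂)) / (1 - Real.exp (-(u₁ + u₂))) ^ 2 * Real.log u₂ ^ 0) +
      (∫ η in Ioc (0 : ℝ) 1, (η * (∫ u in Ioi (0 : ℝ), Real.log u ^ 0 * Real.log (η / u) ^ 0 *
            (Real.exp (-(u + η / u)) / (1 - Real.exp (-(u + η / u))) ^ 2) / u) -
          ∫ v in Ioc (0 : ℝ) 1, ((-(Real.log (1 / η) / 2) + Real.log v) ^ 0 * (-(Real.log (1 / η) / 2) - Real.log v) ^ 0 +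
              (-(Real.log (1 / η) / 2) - Real.log v) ^ 0 * (-(Real.log (1 / η) / 2) + Real.log v) ^ 0) *
            (v / (1 + v ^ 2) ^ 2)) / η), C, fun y hy hy1 ↦ ?_⟩
  have h := hC y hy hy1
  simp only [Finset.sum_range_succ, Finset.sum_range_zero, zero_add, add_zero, Nat.choose_self,
    Nat.cast_one, Nat.sub_self, Nat.cast_zero, Nat.cast_add, pow_zero, pow_one, one_mul, mul_one,
    integral_model_weight_Ioc] at h ⊢
  convert h using 3
  · ring

/-- `(a,b) = (0,1)`: the continued Bose remainder `c_01(y) − Π_01(log(1/y))` is `O(y(1+log(1/y))^2)` on `(0,1]`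
(constants existential). [cite: KowalskiMichelVanderKam2000, (22)–(28) — derivation] -/
theorem exists_bose_rem01_le : ∃ E C : ℝ, ∀ y : ℝ, 0 < y → y ≤ 1 →
    |(∫ u₁ in Ioi (0 : ℝ), ∫ u₂ in Ioi (y / u₁), Real.exp (-(u₁ + u₂)) / (1 - Real.exp (-(u₁ + u₂))) ^ 2 * Real.log u₂) -
        (-(Real.log (1 / y) ^ 2) / 8 + E)| ≤ C * y * (1 + Real.log (1 / y)) ^ 2 := by
  obtain ⟨C, hC⟩ := bose_coeff_structure 0 1
  refine ⟨(∫ u₁ in Ioi (0 : ℝ), Real.log u₁ ^ 0 * ∫ u₂ in Ioi (1 / u₁), Real.exp (-(u₁ + u₂)) / (1 - Real.exp (-(u₁ + u₂))) ^ 2 * Real.log u₂ ^ 1) +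
      (∫ η in Ioc (0 : ℝ) 1, (η * (∫ u in Ioi (0 : ℝ), Real.log u ^ 0 * Real.log (η / u) ^ 1 *
            (Real.exp (-(u + η / u)) / (1 - Real.exp (-(u + η / u))) ^ 2) / u) -
          ∫ v in Ioc (0 : ℝ) 1, ((-(Real.log (1 / η) / 2) + Real.log v) ^ 0 * (-(Real.log (1 / η) / 2) - Real.log v) ^ 1 +
              (-(Real.log (1 / η) / 2) - Real.log v) ^ 0 * (-(Real.log (1 / η) / 2) + Real.log v) ^ 1) *
            (v / (1 + v ^ 2) ^ 2)) / η), C, fun y hy hy1 ↦ ?_⟩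
  have h := hC y hy hy1
  simp only [Finset.sum_range_succ, Finset.sum_range_zero, zero_add, add_zero, Nat.choose_self, Nat.choose_zero_right,
    Nat.cast_one, Nat.sub_self, Nat.sub_zero, Nat.cast_zero, Nat.cast_add, pow_zero, pow_one, one_mul, mul_one,
    integral_model_weight_Ioc] at h ⊢
  convert h using 3
  · ring

/-- `(a,b) = (1,0)`: the continued Bose remainder `c_10(y) − Π_10(log(1/y))` is `O(y(1+log(1/y))^2)` on `(0,1]`
(constants existential). [cite: KowalskiMichelVanderKam2000, (22)–(28) — derivation] -/
theorem exists_bose_rem10_le : ∃ E C : ℝ, ∀ y : ℝ, 0 < y → y ≤ 1 →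
    |(∫ u₁ in Ioi (0 : ℝ), Real.log u₁ * ∫ u₂ in Ioi (y / u₁), Real.exp (-(u₁ + u₂)) / (1 - Real.exp (-(u₁ + u₂))) ^ 2) -
        (-(Real.log (1 / y) ^ 2) / 8 + E)| ≤ C * y * (1 + Real.log (1 / y)) ^ 2 := by
  obtain ⟨C, hC⟩ := bose_coeff_structure 1 0
  refine ⟨(∫ u₁ in Ioi (0 : ℝ), Real.log u₁ ^ 1 * ∫ u₂ in Ioi (1 / u₁), Real.exp (-(u₁ + u₂)) / (1 - Real.exp (-(u₁ + u₂))) ^ 2 * Real.log u₂ ^ 0) +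
      (∫ η in Ioc (0 : ℝ) 1, (η * (∫ u in Ioi (0 : ℝ), Real.log u ^ 1 * Real.log (η / u) ^ 0 *
            (Real.exp (-(u + η / u)) / (1 - Real.exp (-(u + η / u))) ^ 2) / u) -
          ∫ v in Ioc (0 : ℝ) 1, ((-(Real.log (1 / η) / 2) + Real.log v) ^ 1 * (-(Real.log (1 / η) / 2) - Real.log v) ^ 0 +
              (-(Real.log (1 / η) / 2) - Real.log v) ^ 1 * (-(Real.log (1 / η) / 2) + Real.log v) ^ 0) *
            (v / (1 + v ^ 2) ^ 2)) / η), C, fun y hy hy1 ↦ ?_⟩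
  have h := hC y hy hy1
  simp only [Finset.sum_range_succ, Finset.sum_range_zero, zero_add, add_zero, Nat.choose_self, Nat.choose_zero_right,
    Nat.cast_one, Nat.sub_self, Nat.sub_zero, Nat.cast_zero, Nat.cast_add, pow_zero, pow_one, one_mul, mul_one,
    integral_model_weight_Ioc] at h ⊢
  convert h using 3
  · ring

/-- `(a,b) = (1,1)`: the continued Bose remainder `c_11(y) − Π_11(log(1/y))` is `O(y(1+log(1/y))^3)` on `(0,1]`
(constants existential). [cite: KowalskiMichelVanderKam2000, (22)–(28) — derivation] -/
theorem exists_bose_rem11_le : ∃ E μ₂ C : ℝ, ∀ y : ℝ, 0 < y → y ≤ 1 →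
    |(∫ u₁ in Ioi (0 : ℝ), Real.log u₁ * ∫ u₂ in Ioi (y / u₁), Real.exp (-(u₁ + u₂)) / (1 - Real.exp (-(u₁ + u₂))) ^ 2 * Real.log u₂) -
        (Real.log (1 / y) ^ 3 / 24 - 2 * μ₂ * Real.log (1 / y) + E)| ≤ C * y * (1 + Real.log (1 / y)) ^ 3 := by
  obtain ⟨C, hC⟩ := bose_coeff_structure 1 1
  refine ⟨(∫ u₁ in Ioi (0 : ℝ), Real.log u₁ ^ 1 * ∫ u₂ in Ioi (1 / u₁), Real.exp (-(u₁ + u₂)) / (1 - Real.exp (-(u₁ + u₂))) ^ 2 * Real.log u₂ ^ 1) +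
      (∫ η in Ioc (0 : ℝ) 1, (η * (∫ u in Ioi (0 : ℝ), Real.log u ^ 1 * Real.log (η / u) ^ 1 *
            (Real.exp (-(u + η / u)) / (1 - Real.exp (-(u + η / u))) ^ 2) / u) -
          ∫ v in Ioc (0 : ℝ) 1, ((-(Real.log (1 / η) / 2) + Real.log v) ^ 1 * (-(Real.log (1 / η) / 2) - Real.log v) ^ 1 +
              (-(Real.log (1 / η) / 2) - Real.log v) ^ 1 * (-(Real.log (1 / η) / 2) + Real.log v) ^ 1) *
            (v / (1 + v ^ 2) ^ 2)) / η), ∫ v in Ioc (0 : ℝ) 1, Real.log v ^ (1 + 1) * (v / (1 + v ^ 2) ^ 2), C, fun y hy hy1 ↦ ?_⟩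
  have h := hC y hy hy1
  simp only [Finset.sum_range_succ, Finset.sum_range_zero, zero_add, add_zero, Nat.choose_self, Nat.choose_zero_right,
    Nat.cast_one, Nat.sub_self, Nat.sub_zero, Nat.cast_zero, Nat.cast_add, pow_zero, pow_one, one_mul, mul_one,
    integral_model_weight_Ioc] at h ⊢
  convert h using 3
  · ring

end Summit.Parity.GeneralizedHardyLittlewood.Theorems.MomentsBeyondDiagonal.DiagLines

end
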